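import Summits.KontsevichZagierPeriods.Zeta5Search.Barrier.ConeGammaEntropy
import Summits.KontsevichZagierPeriods.Zeta5Search.Barrier.ConeGammaLemmaFWinBoxSound

/-!
# ζ(5) search — BARRIER: THE ENVELOPE BOUND WITHOUT CALCULUS — the value function as 21 entropy forms, secants,
# and the tangent-difference inequality (real side)

HONEST FRAMING (cell `pub-zeta5`): systematic search; no irrationality claim unless kernel-certified. MODEL objects under
Brown–Zudilin's (28)+(30) accounting ([BZ22] = arXiv:2210.03391, §5; (28) observed, not proved): BZ's growth functional
`growthLogR` and its critical values (`ConeGammaRates`), P2 g12's entropy function (`ConeGammaEntropy`). Nothing here is a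
statement about the size of any critical value of record, the cone's supremum (C2 OPEN), S-E (CONJECTURED), (TD_A) or
`ζ(5)`; no number of record moves; records in print UNMOVED. Theory seat cert-2 g39 (item «THE ENVELOPE BOUND FOR C₁
WITHOUT CALCULUS», INBOX plan 2026-08-27), part 1 of 3 (real side; the checker is `ConeGammaEnvelopeCheck`, its soundness
`ConeGammaEnvelopeCert`).

THE IDEA. P2 g12 (`ConeGammaEntropy`) showed that BZ's system `F₁ = F₂ = 0` is the critical system of an entropy function
`G` and that `growthLogR = G + (explicit function of the parameters)` ON the critical set, noting «the calculus step is not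
filed»: along a smooth branch the derivative of a critical value in the direction is `∂G/∂(direction)` (envelope theorem).
Here the first-order consequence is obtained WITHOUT that calculus step. In the shifted symmetric coordinates
`X = x − s₆`, `Y = y − s₆` of cert-2 g37 the full value function is a sum over TWENTY-ONE affine forms
`L_k(s; X, Y) = α_k·s + β_k X + β′_k Y` (P2's fourteen `(x,y)`-forms and the seven constant arguments) of
`σ_k·xlnx(L_k)`, `xlnx(v) = v log|v| − v` (`valueV`; the residual linear part cancels identically), equal to `growthLogR`
at every critical point of a direction of the open box (`growthLogR_eq_valueV`). For a critical point `w(t)` of the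
direction `t` and a critical point `w_c` of the centre `c`, both in a tube `T` on which every form keeps its sign,
`V(t, w(t)) − V(c, w_c) = [V(t, w(t)) − V(c, w(t))] + [V(c, w(t)) − V(c, w_c)]`:
* the first bracket is a sum of SECANTS of `±xlnx` along forms affine in `t`; each secant slope lies between `log m_k`
  and `log M_k` (`xlnx_secant`, from cert-2 g36's `mulLog_secant`) — this is cert-2 g36's hull invariant, no mean-value
  theorem in the direction, no derivative of the root;
* in the second bracket the linear terms are `ΔX·Gx(c, w_c) + ΔY·Gy(c, w_c) = 0` (P2 g12's `entropyGx/Gy_eq_zero` — the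
  critical equations), and what is left is a sum of TANGENT DIFFERENCES `xlnx(b) − xlnx(a) − (b − a)·log|a|`, each bounded
  by `(log M_k − log m_k)·|b − a|` (`xlnx_tangent_diff`) — second-order small on a thin tube.
This file: `EForm`, `vforms`, `formVal`, `valueV`, `gradX/gradY` (the log-forms of `∂V/∂X`, `∂V/∂Y`), the bridges
`gradX_eq_entropyGx`, `gradY_eq_entropyGy`, `valueV_eq`, **`growthLogR_eq_valueV`**, and the two one-form inequalities.
-/

noncomputable section

open Finset Set

namespace Summit.KontsevichZagierPeriods.Zeta5Search.Barrier.ConeGamma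

namespace Envelope

open LemmaFBox (coef featVal)
open LemmaFWinBox (mulLog mulLog_secant)

/-! ### The 21 affine forms and the value function -/

/-- One affine form of the value function: sign `σ`, the eight `s`-coefficients `α`, and the `X`-, `Y`-coefficients. -/
structure EForm where
  /-- sign `σ ∈ {1, −1}` -/
  sg : ℤ
  /-- coefficients of `s₀, …, s₇` -/
  al : List ℤ
  /-- coefficient of `X` -/
  bx : ℤ
  /-- coefficient of `Y` -/
  bY : ℤ
  deriving DecidableEq, Repr

/-- The value of a form at `(s; X, Y)`. -/
def formVal (f : EForm) (s : Fin 8 → ℝ) (X Y : ℝ) : ℝ := featVal f.al s + (f.bx : ℝ) * X + (f.bY : ℝ) * Y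

/-- **The twenty-one forms** (shifted coordinates `X = x − s₆`, `Y = y − s₆`; P2 g12's order for the fourteen `(x,y)`-forms
`x, y, x+y+q₃−p₀−p₆ = X+Y` (sign `+`), `p₁+q₁−x = s₀−X`, `p₂+q₂−x = s₃+s₄+s₅−X`, `x−p₀ = X−s₄`, `x−p₁ = X−s₃`, `x−p₂ = X−s₅`,
`x+y−p₃ = X+Y+s₆−s₀`, `p₄+q₄−y = s₁+s₂+s₇−Y`, `p₅+q₅−y = s₀−Y`, `y−p₄ = Y−s₇`, `y−p₅ = Y−s₂`, `y−p₆ = Y−s₁` (sign `−`), then the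
seven constant arguments `q₁ = s₀−s₃`, `q₂ = s₃+s₄`, `q₄ = s₁+s₂`, `q₅ = s₀−s₂` (sign `+`), `p₀ = s₄+s₆`, `p₃+q₃−p₀−p₆ = s₀−s₆`,
`p₆ = s₁+s₆` (sign `−`)). -/
def vforms : List EForm :=
  [⟨1, [0,0,0,0,0,0,1,0], 1, 0⟩, ⟨1, [0,0,0,0,0,0,1,0], 0, 1⟩, ⟨1, [0,0,0,0,0,0,0,0], 1, 1⟩,
   ⟨-1, [1,0,0,0,0,0,0,0], -1, 0⟩, ⟨-1, [0,0,0,1,1,1,0,0], -1, 0⟩, ⟨-1, [0,0,0,0,-1,0,0,0], 1, 0⟩,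
   ⟨-1, [0,0,0,-1,0,0,0,0], 1, 0⟩, ⟨-1, [0,0,0,0,0,-1,0,0], 1, 0⟩, ⟨-1, [-1,0,0,0,0,0,1,0], 1, 1⟩,
   ⟨-1, [0,1,1,0,0,0,0,1], 0, -1⟩, ⟨-1, [1,0,0,0,0,0,0,0], 0, -1⟩, ⟨-1, [0,0,0,0,0,0,0,-1], 0, 1⟩,
   ⟨-1, [0,0,-1,0,0,0,0,0], 0, 1⟩, ⟨-1, [0,-1,0,0,0,0,0,0], 0, 1⟩,
   ⟨1, [1,0,0,-1,0,0,0,0], 0, 0⟩, ⟨1, [0,0,0,1,1,0,0,0], 0, 0⟩, ⟨1, [0,1,1,0,0,0,0,0], 0, 0⟩, ⟨1, [1,0,-1,0,0,0,0,0], 0, 0⟩,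
   ⟨-1, [0,0,0,0,1,0,1,0], 0, 0⟩, ⟨-1, [1,0,0,0,0,0,-1,0], 0, 0⟩, ⟨-1, [0,1,0,0,0,0,1,0], 0, 0⟩]

/-- The value-function contribution of a list of forms: `Σ σ_k·xlnx(L_k)`. -/
def valF (F : List EForm) (s : Fin 8 → ℝ) (X Y : ℝ) : ℝ := (F.map fun f => (f.sg : ℝ) * xlnx (formVal f s X Y)).sum

/-- The `X`-log-form `Σ σ_k β_k log|L_k|` of a list of forms (`= ∂(valF)/∂X` away from the zero loci). -/
def gxF (F : List EForm) (s : Fin 8 → ℝ) (X Y : ℝ) : ℝ :=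
  (F.map fun f => (f.sg : ℝ) * f.bx * Real.log |formVal f s X Y|).sum

/-- The `Y`-log-form `Σ σ_k β′_k log|L_k|`. -/
def gyF (F : List EForm) (s : Fin 8 → ℝ) (X Y : ℝ) : ℝ :=
  (F.map fun f => (f.sg : ℝ) * f.bY * Real.log |formVal f s X Y|).sum

/-- **The value function** `V(s; X, Y) = Σ_{k<21} σ_k·xlnx(L_k(s; X, Y))`. -/
def valueV (s : Fin 8 → ℝ) (X Y : ℝ) : ℝ := valF vforms s X Y

/-- `valF` of a cons. -/
theorem valF_cons (f : EForm) (F : List EForm) (s : Fin 8 → ℝ) (X Y : ℝ) :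
    valF (f :: F) s X Y = (f.sg : ℝ) * xlnx (formVal f s X Y) + valF F s X Y := by
  simp [valF]

/-- `gxF` of a cons. -/
theorem gxF_cons (f : EForm) (F : List EForm) (s : Fin 8 → ℝ) (X Y : ℝ) :
    gxF (f :: F) s X Y = (f.sg : ℝ) * f.bx * Real.log |formVal f s X Y| + gxF F s X Y := by
  simp [gxF]

/-- `gyF` of a cons. -/
theorem gyF_cons (f : EForm) (F : List EForm) (s : Fin 8 → ℝ) (X Y : ℝ) :
    gyF (f :: F) s X Y = (f.sg : ℝ) * f.bY * Real.log |formVal f s X Y| + gyF F s X Y := by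
  simp [gyF]

/-- The empty list contributes nothing. -/
theorem valF_nil (s : Fin 8 → ℝ) (X Y : ℝ) : valF [] s X Y = 0 := by simp [valF]
/-- The empty list contributes nothing. -/
theorem gxF_nil (s : Fin 8 → ℝ) (X Y : ℝ) : gxF [] s X Y = 0 := by simp [gxF]
/-- The empty list contributes nothing. -/
theorem gyF_nil (s : Fin 8 → ℝ) (X Y : ℝ) : gyF [] s X Y = 0 := by simp [gyF]

/-! ### Bridges to P2 g12's entropy function and to `growthLogR` -/

/-- The value function written out. -/
theorem valueV_eq (s : Fin 8 → ℝ) (X Y : ℝ) :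
    valueV s X Y = xlnx (X + s 6) + xlnx (Y + s 6) + xlnx (X + Y)
      - xlnx (s 0 - X) - xlnx (s 3 + s 4 + s 5 - X) - xlnx (X - s 4) - xlnx (X - s 3) - xlnx (X - s 5)
      - xlnx (X + Y + s 6 - s 0)
      - xlnx (s 1 + s 2 + s 7 - Y) - xlnx (s 0 - Y) - xlnx (Y - s 7) - xlnx (Y - s 2) - xlnx (Y - s 1)
      + xlnx (s 0 - s 3) + xlnx (s 3 + s 4) + xlnx (s 1 + s 2) + xlnx (s 0 - s 2)
      - xlnx (s 4 + s 6) - xlnx (s 0 - s 6) - xlnx (s 1 + s 6) := by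
  simp only [valueV, valF, vforms, formVal, featVal, coef, List.map_cons, List.map_nil, List.sum_cons, List.sum_nil,
    Fin.sum_univ_eight]
  simp
  ring_nf

/-- The `X`-log-form of `vforms` is P2 g12's `entropyGx` (shifted coordinates). -/
theorem gradX_eq_entropyGx (s : Fin 8 → ℝ) (X Y : ℝ) :
    gxF vforms s X Y = entropyGx (pR (aOfS s)) (qR (aOfS s)) (X + s 6) (Y + s 6) := by
  simp only [gxF, vforms, formVal, featVal, coef, List.map_cons, List.map_nil, List.sum_cons, List.sum_nil,
    Fin.sum_univ_eight, entropyGx, pR, qR, aOfS]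
  simp
  ring_nf

/-- The `Y`-log-form of `vforms` is P2 g12's `entropyGy` (shifted coordinates). -/
theorem gradY_eq_entropyGy (s : Fin 8 → ℝ) (X Y : ℝ) :
    gyF vforms s X Y = entropyGy (pR (aOfS s)) (qR (aOfS s)) (X + s 6) (Y + s 6) := by
  simp only [gyF, vforms, formVal, featVal, coef, List.map_cons, List.map_nil, List.sum_cons, List.sum_nil,
    Fin.sum_univ_eight, entropyGy, pR, qR, aOfS]
  simp
  ring_nf

/-- The entropy part: the first fourteen forms give P2 g12's `entropyG` in shifted coordinates. -/
theorem entropyG_aOfS_eq (s : Fin 8 → ℝ) (X Y : ℝ) :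
    entropyG (pR (aOfS s)) (qR (aOfS s)) (X + s 6) (Y + s 6)
      = xlnx (X + s 6) + xlnx (Y + s 6) + xlnx (X + Y)
      - xlnx (s 0 - X) - xlnx (s 3 + s 4 + s 5 - X) - xlnx (X - s 4) - xlnx (X - s 3) - xlnx (X - s 5)
      - xlnx (X + Y + s 6 - s 0)
      - xlnx (s 1 + s 2 + s 7 - Y) - xlnx (s 0 - Y) - xlnx (Y - s 7) - xlnx (Y - s 2) - xlnx (Y - s 1) := by
  simp only [entropyG, pR, qR, aOfS]
  simp
  ring_nf

/-- The seven constant arguments in symmetric parameters. -/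
theorem constArgs_aOfS (s : Fin 8 → ℝ) :
    constArgs (pR (aOfS s)) (qR (aOfS s)) = ![s 0 - s 3, s 3 + s 4, s 1 + s 2, s 0 - s 2, s 4 + s 6, s 0 - s 6, s 1 + s 6] := by
  ext k; fin_cases k <;> simp [constArgs, pR, qR, aOfS] <;> ring

/-- The residual linear constant `p₃ + q₃ − q₁ − q₂ − q₄ − q₅ = s₆ − s₀`. -/
theorem linConst_aOfS (s : Fin 8 → ℝ) :
    pR (aOfS s) 3 + qR (aOfS s) 2 - qR (aOfS s) 0 - qR (aOfS s) 1 - qR (aOfS s) 3 - qR (aOfS s) 4 = s 6 - s 0 := by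
  simp [pR, qR, aOfS]; ring

/-- **`growthLogR = valueV` at every critical point of a direction of the open box** (P2 g12's value identity
`growthLogR_eq_entropyG_of_isCritical` plus the bookkeeping of the seven constant arguments: their `c log c` equal
`xlnx(c) + c` (`c > 0` on the open box) and the residual linear part `(p₃+q₃−q₁−q₂−q₄−q₅) + Σ ± c_k = 0` cancels). -/
theorem growthLogR_eq_valueV {s : Fin 8 → ℝ} (hbox : ∀ j : Fin 7, 0 < s j.succ ∧ s j.succ < s 0) {X Y : ℝ}
    (hc : IsCritical (aOfS s) (X + s 6) (Y + s 6)) (hx : X + s 6 ≠ 0) (hy : Y + s 6 ≠ 0) :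
    growthLogR (pR (aOfS s)) (qR (aOfS s)) (X + s 6) (Y + s 6) = valueV s X Y := by
  rw [growthLogR_eq_entropyG_of_isCritical hc hx hy, entropyG_aOfS_eq, linConst_aOfS, constArgs_aOfS, valueV_eq]
  have h1 := hbox 0; have h2 := hbox 1; have h3 := hbox 2; have h4 := hbox 3; have h6 := hbox 5
  change 0 < s 1 ∧ s 1 < s 0 at h1; change 0 < s 2 ∧ s 2 < s 0 at h2; change 0 < s 3 ∧ s 3 < s 0 at h3
  change 0 < s 4 ∧ s 4 < s 0 at h4; change 0 < s 6 ∧ s 6 < s 0 at h6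
  have pos_xlnx : ∀ c : ℝ, 0 < c → c * Real.log c = xlnx c + c := fun c hc => by
    rw [xlnx, abs_of_pos hc]; ring
  simp only [constSigns, Fin.sum_univ_succ, Fin.sum_univ_zero, Matrix.cons_val_zero, Matrix.cons_val_succ,
    one_mul, neg_mul, add_zero]
  rw [pos_xlnx (s 0 - s 3) (by linarith), pos_xlnx (s 3 + s 4) (by linarith), pos_xlnx (s 1 + s 2) (by linarith),
    pos_xlnx (s 0 - s 2) (by linarith), pos_xlnx (s 4 + s 6) (by linarith), pos_xlnx (s 0 - s 6) (by linarith),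
    pos_xlnx (s 1 + s 6) (by linarith)]
  ring

/-- **At a critical point both log-forms vanish** (the critical equations `F₁ = F₂ = 0` in P2 g12's logarithmic form). -/
theorem gradXY_eq_zero_of_isCritical {s : Fin 8 → ℝ} {X Y : ℝ} (hc : IsCritical (aOfS s) (X + s 6) (Y + s 6))
    (hx : X + s 6 ≠ 0) (hy : Y + s 6 ≠ 0) : gxF vforms s X Y = 0 ∧ gyF vforms s X Y = 0 := by
  obtain ⟨h1, h2, hF⟩ := hc
  have f0 := hF 0; have f1 := hF 1; have f2 := hF 2; have f3 := hF 3; have f4 := hF 4; have f5 := hF 5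
  have f6 := hF 6; have f7 := hF 7; have f8 := hF 8; have f9 := hF 9; have f10 := hF 10; have f11 := hF 11
  simp only [critFactors, Matrix.cons_val_zero, Matrix.cons_val_one, Matrix.cons_val] at f0 f1 f2 f3 f4 f5 f6 f7 f8 f9 f10 f11
  rw [gradX_eq_entropyGx, gradY_eq_entropyGy]
  exact ⟨entropyGx_eq_zero h1 hx f0 f1 f2 f3 f4 f5 f6, entropyGy_eq_zero h2 hy f3 f6 f7 f8 f9 f10 f11⟩

/-! ### The two one-form inequalities for `xlnx` -/

/-- `xlnx` on the negative axis: `xlnx(−u) = −(u log u) + u`. -/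
theorem xlnx_neg_eq (u : ℝ) : xlnx (-u) = -mulLog u + u := by
  unfold xlnx mulLog
  rw [abs_neg, Real.log_abs]
  ring

/-- `xlnx` on the positive axis: `xlnx(u) = u log u − u`. -/
theorem xlnx_pos_eq {u : ℝ} (hu : 0 < u) : xlnx u = mulLog u - u := by
  simp [xlnx, mulLog, abs_of_pos hu]

/-- **Secant enclosure for `xlnx`**: for `a`, `b` of the same strict sign with `m ≤ |a|, |b| ≤ M` (`m > 0`), the secant
slope of `xlnx` between `a` and `b` lies in `[log m, log M]`: `xlnx b − xlnx a = θ·(b − a)`, `log m ≤ θ ≤ log M`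
(cert-2 g36's `mulLog_secant`; `(v log|v| − v)′ = log|v|` — but no derivative is taken here). -/
theorem xlnx_secant {m M a b : ℝ} (hm : 0 < m)
    (hsign : (m ≤ a ∧ a ≤ M ∧ m ≤ b ∧ b ≤ M) ∨ (m ≤ -a ∧ -a ≤ M ∧ m ≤ -b ∧ -b ≤ M)) :
    ∃ θ : ℝ, Real.log m ≤ θ ∧ θ ≤ Real.log M ∧ xlnx b - xlnx a = θ * (b - a) := by
  -- the positive case for ordered arguments
  have key : ∀ {u v : ℝ}, m ≤ u → u ≤ M → m ≤ v → v ≤ M → u ≤ v →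
      ∃ θ : ℝ, Real.log m ≤ θ ∧ θ ≤ Real.log M ∧ mulLog v - mulLog u - (v - u) = θ * (v - u) := by
    intro u v hu huM hv hvM huv
    rcases huv.eq_or_lt with h | hlt
    · subst h
      exact ⟨Real.log m, le_rfl, Real.log_le_log hm (hu.trans huM), by simp⟩
    · obtain ⟨h1, h2⟩ := mulLog_secant hm hu huv hvM
      refine ⟨(mulLog v - mulLog u) / (v - u) - 1, ?_, ?_, ?_⟩
      · have : v - u > 0 := sub_pos.mpr hlt
        rw [le_sub_iff_add_le, le_div_iff₀ this]; linarith
      · have : v - u > 0 := sub_pos.mpr hlt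
        rw [sub_le_iff_le_add, div_le_iff₀ this]; linarith
      · have : v - u ≠ 0 := (sub_pos.mpr hlt).ne'
        field_simp
  rcases hsign with ⟨ha, haM, hb, hbM⟩ | ⟨ha, haM, hb, hbM⟩
  · have ha0 : 0 < a := hm.trans_le ha
    have hb0 : 0 < b := hm.trans_le hb
    rw [xlnx_pos_eq ha0, xlnx_pos_eq hb0]
    rcases le_total a b with hab | hba
    · obtain ⟨θ, h1, h2, e⟩ := key ha haM hb hbM hab
      exact ⟨θ, h1, h2, by linarith⟩
    · obtain ⟨θ, h1, h2, e⟩ := key hb hbM ha haM hba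
      exact ⟨θ, h1, h2, by linarith⟩
  · have ea : a = -(-a) := by ring
    have eb : b = -(-b) := by ring
    rw [ea, eb, xlnx_neg_eq, xlnx_neg_eq]
    rcases le_total (-a) (-b) with hab | hba
    · obtain ⟨θ, h1, h2, e⟩ := key ha haM hb hbM hab
      exact ⟨θ, h1, h2, by linarith⟩
    · obtain ⟨θ, h1, h2, e⟩ := key hb hbM ha haM hba
      exact ⟨θ, h1, h2, by linarith⟩

/-- **Tangent-difference inequality for `xlnx`**: under the same hypotheses,
`|xlnx b − xlnx a − (b − a)·log|a|| ≤ (log M − log m)·|b − a|` — the linear term is the TANGENT at `a`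
(`(xlnx)′(a) = log|a|`), and the secant slope and `log|a|` both lie in `[log m, log M]`. -/
theorem xlnx_tangent_diff {m M a b : ℝ} (hm : 0 < m)
    (hsign : (m ≤ a ∧ a ≤ M ∧ m ≤ b ∧ b ≤ M) ∨ (m ≤ -a ∧ -a ≤ M ∧ m ≤ -b ∧ -b ≤ M)) :
    |xlnx b - xlnx a - (b - a) * Real.log (|a|)| ≤ (Real.log M - Real.log m) * |b - a| := by
  obtain ⟨θ, h1, h2, e⟩ := xlnx_secant hm hsign
  have hla : Real.log m ≤ Real.log |a| ∧ Real.log |a| ≤ Real.log M := by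
    rcases hsign with ⟨ha, haM, _, _⟩ | ⟨ha, haM, _, _⟩
    · have ha0 : 0 < a := hm.trans_le ha
      rw [abs_of_pos ha0]
      exact ⟨Real.log_le_log hm ha, Real.log_le_log ha0 haM⟩
    · have ha0 : 0 < -a := hm.trans_le ha
      rw [show |a| = -a by rw [abs_of_neg (by linarith)]]
      exact ⟨Real.log_le_log hm ha, Real.log_le_log ha0 haM⟩
  rw [e, show θ * (b - a) - (b - a) * Real.log |a| = (θ - Real.log |a|) * (b - a) by ring, abs_mul]
  refine mul_le_mul_of_nonneg_right ?_ (abs_nonneg _)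
  rw [abs_le]; constructor <;> linarith

/-! ### Second order: the quadratic bounds for `u log u − u + 1` and the tangent difference of `xlnx` -/

/-- `h(u) = u log u − u + 1 − (u−1)²/2` is antitone on `(0, ∞)` (`h′ = log u − (u − 1) ≤ 0`). -/
theorem psi_aux_antitone :
    AntitoneOn (fun u : ℝ => u * Real.log u - u + 1 - (u - 1) ^ 2 / 2) (Ioi 0) := by
  have hderiv : ∀ x ∈ Ioi (0 : ℝ), HasDerivAt (fun u : ℝ => u * Real.log u - u + 1 - (u - 1) ^ 2 / 2)
      (Real.log x - (x - 1)) x := by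
    intro x hx
    have h1 := Real.hasDerivAt_mul_log (ne_of_gt hx)
    have h2 := (((hasDerivAt_id' x).sub_const (1 : ℝ)).pow 2).div_const (2 : ℝ)
    exact ((((h1.sub (hasDerivAt_id' x)).add_const (1 : ℝ)).sub h2)).congr_deriv (by ring)
  refine antitoneOn_of_deriv_nonpos (convex_Ioi 0) ?_ ?_ ?_
  · exact fun x hx => (hderiv x hx).continuousAt.continuousWithinAt
  · rw [interior_Ioi]; exact fun x hx => (hderiv x hx).differentiableAt.differentiableWithinAt
  · rw [interior_Ioi]; intro x hx
    rw [(hderiv x hx).deriv]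
    linarith [Real.log_le_sub_one_of_pos hx]

/-- `g(u) = log u − 3/2 + 2u⁻¹ − (u⁻¹)²/2` is monotone on `(0, ∞)` (`g′ = (u−1)²/u³ ≥ 0`). -/
theorem psi_aux_monotone :
    MonotoneOn (fun u : ℝ => Real.log u - 3 / 2 + 2 * u⁻¹ - (u⁻¹) ^ 2 / 2) (Ioi 0) := by
  have hderiv : ∀ x ∈ Ioi (0 : ℝ), HasDerivAt (fun u : ℝ => Real.log u - 3 / 2 + 2 * u⁻¹ - (u⁻¹) ^ 2 / 2)
      ((x - 1) ^ 2 / x ^ 3) x := by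
    intro x hx
    have hx0 : x ≠ 0 := ne_of_gt hx
    have h1 := Real.hasDerivAt_log hx0
    have h2 := (hasDerivAt_inv hx0).const_mul (2 : ℝ)
    have h3 := ((hasDerivAt_inv hx0).pow 2).div_const (2 : ℝ)
    refine ((((h1.sub_const (3 / 2 : ℝ)).add h2).sub h3)).congr_deriv ?_
    norm_num
    field_simp
    ring
  refine monotoneOn_of_deriv_nonneg (convex_Ioi 0) ?_ ?_ ?_
  · exact fun x hx => (hderiv x hx).continuousAt.continuousWithinAt
  · rw [interior_Ioi]; exact fun x hx => (hderiv x hx).differentiableAt.differentiableWithinAt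
  · rw [interior_Ioi]; intro x hx
    rw [(hderiv x hx).deriv]
    have : (0 : ℝ) < x := hx
    positivity

/-- **Quadratic bounds for `ψ(u) = u log u − u + 1`**: `(u−1)²/(2·max(1,u)) ≤ ψ(u) ≤ (u−1)²/(2·min(1,u))` (`u > 0`). -/
theorem psi_quad_bounds {u : ℝ} (hu : 0 < u) :
    (u - 1) ^ 2 / (2 * max 1 u) ≤ u * Real.log u - u + 1 ∧ u * Real.log u - u + 1 ≤ (u - 1) ^ 2 / (2 * min 1 u) := by
  have h1 : (1 : ℝ) ∈ Ioi (0 : ℝ) := by norm_num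
  have hA := psi_aux_antitone
  have hM := psi_aux_monotone
  have hu' : u ∈ Ioi (0 : ℝ) := hu
  have e1 : (fun u : ℝ => u * Real.log u - u + 1 - (u - 1) ^ 2 / 2) 1 = 0 := by norm_num
  have e2 : (fun u : ℝ => Real.log u - 3 / 2 + 2 * u⁻¹ - (u⁻¹) ^ 2 / 2) 1 = 0 := by norm_num
  have euu : u * u⁻¹ = 1 := mul_inv_cancel₀ hu.ne'
  have hinv : 0 < u⁻¹ := inv_pos.mpr hu
  rcases le_total 1 u with h | h
  · rw [max_eq_right h, min_eq_left h]
    have a := hA h1 hu' h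
    have b := hM h1 hu' h
    rw [e1] at a; rw [e2] at b
    simp only at a b
    constructor
    · have hu2 : (0 : ℝ) < 2 * u := by positivity
      rw [div_le_iff₀ hu2]
      -- from b: log u ≥ 3/2 − 2u⁻¹ + u⁻²/2
      nlinarith [b, euu, hinv, mul_pos hu hu]
    · linarith
  · rw [max_eq_left h, min_eq_right h]
    have a := hA hu' h1 h
    have b := hM hu' h1 h
    rw [e1] at a; rw [e2] at b
    simp only at a b
    constructor
    · linarith
    · have hu2 : (0 : ℝ) < 2 * u := by positivity
      rw [le_div_iff₀ hu2]
      nlinarith [b, euu, hinv, mul_pos hu hu]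

/-- **Second-order two-sided bound for the tangent difference of `xlnx`** on the positive side: for `m ≤ a, b ≤ M`
(`m > 0`), `(b − a)²/(2M) ≤ xlnx b − xlnx a − (b − a)·log|a| ≤ (b − a)²/(2m)` (the tangent difference is `a·ψ(b/a)`). -/
theorem xlnx_tangent_quad_pos {m M a b : ℝ} (hm : 0 < m) (ha : m ≤ a) (haM : a ≤ M) (hb : m ≤ b) (hbM : b ≤ M) :
    (b - a) ^ 2 / (2 * M) ≤ xlnx b - xlnx a - (b - a) * Real.log (|a|) ∧
      xlnx b - xlnx a - (b - a) * Real.log (|a|) ≤ (b - a) ^ 2 / (2 * m) := by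
  have ha0 : 0 < a := hm.trans_le ha
  have hb0 : 0 < b := hm.trans_le hb
  have hM0 : 0 < M := ha0.trans_le haM
  set u := b / a with hu
  have hu0 : 0 < u := div_pos hb0 ha0
  have ebu : b = a * u := by rw [hu]; field_simp
  have eT : xlnx b - xlnx a - (b - a) * Real.log (|a|) = a * (u * Real.log u - u + 1) := by
    rw [xlnx, xlnx, abs_of_pos ha0, abs_of_pos hb0, ebu, Real.log_mul ha0.ne' hu0.ne']
    ring
  have esq : (b - a) ^ 2 = a ^ 2 * (u - 1) ^ 2 := by rw [ebu]; ring
  obtain ⟨q1, q2⟩ := psi_quad_bounds hu0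
  rw [eT, esq]
  constructor
  · -- lower: a²(u−1)²/(2M) ≤ a·(u−1)²/(2 max 1 u) since a·max(1,u) = max(a,b) ≤ M
    have hmax : a * max 1 u ≤ M := by
      rcases le_total 1 u with h | h
      · rw [max_eq_right h, ← ebu]; exact hbM
      · rw [max_eq_left h, mul_one]; exact haM
    have hmax0 : 0 < a * max 1 u := by positivity
    calc a ^ 2 * (u - 1) ^ 2 / (2 * M) ≤ a ^ 2 * (u - 1) ^ 2 / (2 * (a * max 1 u)) := by
          apply div_le_div_of_nonneg_left (by positivity) (by positivity)
          linarith
      _ = a * ((u - 1) ^ 2 / (2 * max 1 u)) := by field_simp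
      _ ≤ a * (u * Real.log u - u + 1) := mul_le_mul_of_nonneg_left q1 ha0.le
  · have hmin : m ≤ a * min 1 u := by
      rcases le_total 1 u with h | h
      · rw [min_eq_left h, mul_one]; exact ha
      · rw [min_eq_right h, ← ebu]; exact hb
    have hmin0 : 0 < a * min 1 u := by
      have : 0 < min 1 u := lt_min one_pos hu0
      positivity
    calc a * (u * Real.log u - u + 1) ≤ a * ((u - 1) ^ 2 / (2 * min 1 u)) := mul_le_mul_of_nonneg_left q2 ha0.le
      _ = a ^ 2 * (u - 1) ^ 2 / (2 * (a * min 1 u)) := by field_simp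
      _ ≤ a ^ 2 * (u - 1) ^ 2 / (2 * m) := by
          apply div_le_div_of_nonneg_left (by positivity) (by positivity)
          linarith

/-- The same on the negative side: for `m ≤ −a, −b ≤ M`, the tangent difference is `−(−a)·ψ(b/a)`:
`(b − a)²/(2M) ≤ −(xlnx b − xlnx a − (b − a)·log|a|) ≤ (b − a)²/(2m)`. -/
theorem xlnx_tangent_quad_neg {m M a b : ℝ} (hm : 0 < m) (ha : m ≤ -a) (haM : -a ≤ M) (hb : m ≤ -b) (hbM : -b ≤ M) :
    (b - a) ^ 2 / (2 * M) ≤ -(xlnx b - xlnx a - (b - a) * Real.log (|a|)) ∧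
      -(xlnx b - xlnx a - (b - a) * Real.log (|a|)) ≤ (b - a) ^ 2 / (2 * m) := by
  obtain ⟨h1, h2⟩ := xlnx_tangent_quad_pos hm ha haM hb hbM
  have odd : ∀ v : ℝ, xlnx (-v) = -xlnx v := fun v => by simp only [xlnx, abs_neg]; ring
  have e : -(xlnx b - xlnx a - (b - a) * Real.log (|a|))
      = xlnx (-b) - xlnx (-a) - (-b - -a) * Real.log (|-a|) := by
    rw [odd, odd, abs_neg]; ring
  have esq : (-b - -a) ^ 2 = (b - a) ^ 2 := by ring
  rw [e, ← esq]
  exact ⟨h1, h2⟩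

end Envelope

end Summit.KontsevichZagierPeriods.Zeta5Search.Barrier.ConeGamma

end
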